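import Summits.BirchSwinnertonDyer.Rank1Residual.Additive.KatoDescentRankOnePerrinRiou
import Summits.BirchSwinnertonDyer.Rank1Residual.Additive.KMCTrivialDescentRankOne
import Summits.BirchSwinnertonDyer.Rank1Residual.Additive.O7RankOneCells
import Summits.BirchSwinnertonDyer.Rank1Residual.O6.O6Targets
import HarnessLib

/-!
# The rank-ONE descent `KMC_p(f_E)⁰ → PR^× → BSD_p` at an additive potentially good `p ≠ 2` under
# (12.5.2), and the Burns–Kurihara–Sano triangle — kernel assemblies over the SPLIT readings
# (cell `bsd-potss`, seat `kmc`, generation 2; part 6 of the descent files)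

HONEST FRAMING (cell `bsd-potss`; memo of record `pub/bsd-potss/bsd-potss-kmc/KMC-DESCENT-MEMO.md`
v2): nothing asserted; theorems only, every input a hypothesis. Inputs: the PRINTED-shape rank-one
count `RankOneCountReading IsOf PRRatio`, the realizability `HasPRRatio PRRatio` (part 5,
`Additive/KatoDescentRankOnePerrinRiou.lean`), `DivisibilityReading` / `Realizable` /
`ReadsTrivialKMC` (part 1, `Additive/KatoDescentDatum.lean`), Gross–Zagier–Kolyvagin `hGZK`,
modularity `hmod` (for `L′(W,1) ≠ 0`), the landed descent theorem
`Kato2004.index_zeta_eq_natCard_coinvariants_of_conj_12_10` with its converse and the module-theoretic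
Thm. 14.5 (3); and, PER PAIR, the conjecture node `PerrinRiouUpToUnitAt PRRatio W p` (PR^×, T-O6-A1′;
Burns–Kurihara–Sano Conj. 2.8 / 1.5, Perrin-Riou 1993 §3.3) and the interface `KMC W p`.

OUTPUT (`r_an = 1`, `p ≠ 2` additive potentially good, (12.5.2) — O6 wild X4, O5 (t′)/Gss, and the
pot-good rows of O7-ord alike):
* `rankOne_missingPPartAt_of_kmc_of_perrinRiou` — **KMC⁰(W,p) → PR^×(W,p) → BSD_p(W)** (both halves),
  NO `p`-adic height (Burns–Kurihara–Sano Thm. 7.6 at `r = 1` with `R^{Boc} = log_ω(x)·x ≠ 0`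
  automatic, in Kato's `𝐇²`-formalism; the kernel transcription);
* the TRIANGLE (their Thm. 7.3: "IMC alone fixes `z` up to `ℤ_p^×` as `(#Ш·Tam/#tors²)·log_ω(x)·x`"):
  `perrinRiouUpToUnitAt_of_kmc_of_missingPPartAt` — **KMC⁰ ∧ BSD_p ⇒ PR^×**;
  `conj1210_of_perrinRiou_of_missingLowerBoundAt` — **PR^× ∧ (BSD_p's lower half) ⇒ Conj. 12.10⁰**
  for every realised datum (Kato 12.5 (4) + the converse descent); hence
  `rankOne_kmc_iff_missingPPartAt_of_perrinRiou` and `missingPPartAt_iff_perrinRiou_of_kmc`;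
* `perrinRiou_nonvanishing_of_kmc` — **KMC⁰ ⇒ Perrin-Riou's NON-VANISHING** `z ≠ 0` in
  `H¹(ℤ[1/p], V)` (Burns–Kurihara–Sano Conj. 2.8 (i) in analytic rank one) for free;
* the SHELLS re-glued through the named node: **T-O6-A (A1) `O6.RankOneOfKMC KMC PR (12.5.2)`**
  (`O6.rankOneOfKMC_of_perrinRiou_readings`: the third interface slot `HtNondeg` is instantiated by
  Kato's (12.5.2), which is what the descent needs and which EXCLUDES the X3 = reducible rows — no
  `p`-adic height is used), and **B8 = O7-ss** on its (12.5.2) rows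
  (`O7.missingPPartAt_ss_of_kmc_of_perrinRiou`: `KMC⁰ ∧ PR^× ⇒ MissingPPartAt` on `O7.SS W p`).
So on the (12.5.2) rows the rank-one residue of O6 / O5 / B8 in Kato's currency is EXACTLY
`KMC⁰ + PR^×` — both NAMED: Kato Conj. 12.10 (trivial component) and Burns–Kurihara–Sano Conj. 2.8 /
1.5 = Perrin-Riou 1993 — and NEITHER is "missing in print" (corrects the dead-end note "PRKato NOT in
print" of the `O6.RankOneOfKMC` docstring: conjecture in print at every `p`, theorem for `p ∤ 2N`,
Burungale–Skinner–Tian–Wan Thm. 6.4; theorem conditional on IMC + Conj. 1.5 at ANY reduction,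
Burns–Kurihara–Sano Thm. 7.6 / Rem. 7.7).

WHAT THIS IS NOT: not a proof of PR^× or of KMC for any pair; nothing at `p = 2`, at a potentially
multiplicative `p`, without (12.5.2) (X3 rows: `O6.X3WildOfKMC`, `μ > 0` transport — not here), or
in analytic rank `≠ 1`; no census number is used; nothing is booked.
References: Burns–Kurihara–Sano arXiv:1910.07404 Thm. 1.4, Conj. 1.5, Rem. 1.7, Conj. 2.8, Thm. 7.3,
Thm. 7.6, Rem. 7.7, Thm. 7.8 [BurnsKuriharaSano2019]; K. Kato, Astérisque 295 (2004) Conj. 12.10,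
Thm. 12.5 (4), (12.5.2), Thm. 14.5 (3), (14.9.3), §14.14 [Kato2004Asterisque]; B. Perrin-Riou, Ann.
Inst. Fourier 43 (1993) §3.3 [PerrinRiou1993AIF]; R. L. Miller, LMS JCM 14 (2011) Def. 1.1 [Miller2011LMS].
-/

set_option autoImplicit false

noncomputable section

open scoped Classical

open WeierstrassCurve Literature.NumberTheory.EllipticCurves
  Literature.NumberTheory.EllipticCurves.Rank1Residual
  Literature.NumberTheory.EllipticCurves.Rank1Residual.Typed
  Literature.NumberTheory.EllipticCurves.IwasawaAlgebra

namespace Summit.BirchSwinnertonDyer.Rank1Residual.Additive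

variable {IsOf : ∀ (W : WeierstrassCurve ℚ) [W.IsElliptic] [W.IsGloballyMinimal] (p : ℕ) [Fact p.Prime],
  KatoDescentDatum p → Prop}
variable {PRRatio : ∀ (W : WeierstrassCurve ℚ) [W.IsElliptic] [W.IsGloballyMinimal] (p : ℕ)
  [Fact p.Prime], ℚ_[p] → Prop}
variable {KMC : ∀ (W : WeierstrassCurve ℚ) [W.IsElliptic] [W.IsGloballyMinimal] (p : ℕ), Prop}

/-! ## §1 The descent KMC⁰ → PR^× → BSD_p in analytic rank one -/

section Descent

variable (W : WeierstrassCurve ℚ) [W.IsElliptic] [W.IsGloballyMinimal] (p : ℕ) [Fact p.Prime]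

omit [W.IsElliptic] [W.IsGloballyMinimal] in
/-- `ord_p #Ш(E)(p) = ord_p #Ш(E)` (the `p`-primary component carries the `p`-part). [folklore] -/
private theorem padicValNat_primaryComponent_sha (hfin : Finite W.sha) :
    padicValNat p (Nat.card (AddCommGroup.primaryComponent W.sha p)) = padicValNat p W.shaOrder := by
  haveI := hfin
  unfold WeierstrassCurve.shaOrder
  exact padicValNat_card_addPrimaryComponent p

/-- **Rank one: KMC⁰(W,p) → PR^×(W,p) → BSD_p(W) (both halves)** at an odd additive potentially good
`p` under (12.5.2), over Reading 1″ (printed count), Reading 3 (realizability) and the interface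
lemma — NO `p`-adic height. Conj. 12.10⁰ gives `[H¹(ℤ[1/p],T) : z] = #H²` (the zeta element
survives and `m = 0`), the count gives `v_p(ℒ) = ord_p #Ш + ord_p Tam`, PR^× gives
`v_p(ℒ) = ord_p(L′/(Ω·Reg))`, whence `ord_p #Ш_an = ord_p #Ш` (`p ∤ #tors`). = Burns–Kurihara–Sano
Thm. 7.6 at `r = 1` restricted to the (12.5.2) rows, in Kato's `𝐇²`-formalism (their Hyp. 2.2 (i)
⟸ `E[p]` irreducible ⟸ (12.5.2); (ii),(iii) ⟸ `r_an = 1` + Gross–Zagier–Kolyvagin; `R^{Boc} =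
log_ω(x)·x ≠ 0` automatic). [cite: BurnsKuriharaSano2019, Thm. 7.6 and Remark 7.7 (p. 29)]
[cite: Kato2004Asterisque, Conj. 12.10 (p. 224), §14.14 (p. 243)] [cite: PerrinRiou1993AIF, §3.3] -/
theorem rankOne_missingPPartAt_of_kmc_of_perrinRiou (hC : RankOneCountReading IsOf PRRatio)
    (hreal : Realizable IsOf) (hread : ReadsTrivialKMC IsOf KMC)
    (hGZK : rank_eq_analyticRank_of_analyticRank_le_one) (hmod : hasEntireLFunction_rat)
    (hr : W.analyticRank = 1) (hp : p ≠ 2) (hadd : Addv W p) (hj : 0 ≤ padicValRat p W.j)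
    (hK : Kato2004.ImageContainsSL2 W p) (hPR : PerrinRiouUpToUnitAt PRRatio W p)
    (hKMC : KMC W p) : MissingPPartAt W p := by
  have hfin : Finite W.sha := (hGZK W (by rw [hr])).2
  obtain ⟨D, hDof⟩ := hreal W p hp hadd hj hK
  obtain ⟨ℒ, hℒ, -, q, hq, hv⟩ := hPR hr
  obtain ⟨hfinH2, -, hcount⟩ := hC W p D ℒ hr hp hadd hj hK hfin hDof hℒ
  have hμ : D.zetaIndex = D.h2Card :=
    D.zetaIndex_eq_h2Card_of_conj1210 hfinH2 ((hread W p D hDof).mp hKMC)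
  have hval := hcount 0 (by rw [pow_zero, one_mul]; exact hμ)
  obtain ⟨q', hq', hv'⟩ := exists_shaAn_eq_of_leadingTerm_eq W p (irr_of_imageContainsSL2 W p hK)
    (W.leadingLCoeff_ne_zero_holds (hmod W)) hq
  refine ⟨q', hq', ?_⟩
  rw [hv', ← hv, hval, padicValNat_primaryComponent_sha W p hfin]
  push_cast
  ring

/-- **`BSD(E,p)` in analytic rank one from KMC⁰ and PR^× over the split readings** (Miller's
`BSDp`). [cite: BurnsKuriharaSano2019, Thm. 7.6 (p. 29)] [cite: Miller2011LMS, Def. 1.1] -/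
theorem rankOne_bsdp_of_kmc_of_perrinRiou (hC : RankOneCountReading IsOf PRRatio)
    (hreal : Realizable IsOf) (hread : ReadsTrivialKMC IsOf KMC)
    (hGZK : rank_eq_analyticRank_of_analyticRank_le_one) (hmod : hasEntireLFunction_rat)
    (hr : W.analyticRank = 1) (hp : p ≠ 2) (hadd : Addv W p) (hj : 0 ≤ padicValRat p W.j)
    (hK : Kato2004.ImageContainsSL2 W p) (hPR : PerrinRiouUpToUnitAt PRRatio W p)
    (hKMC : KMC W p) : BSDp W p :=
  bsdp_of_missingPPartAt W p hGZK (by rw [hr])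
    (rankOne_missingPPartAt_of_kmc_of_perrinRiou W p hC hreal hread hGZK hmod hr hp hadd hj hK hPR
      hKMC)

/-! ## §2 The Burns–Kurihara–Sano triangle: any two of {KMC⁰, BSD_p, PR^×} give the third -/

/-- **KMC⁰ ⇒ Perrin-Riou's NON-VANISHING in analytic rank one** (`z ≠ 0` in `H¹(ℤ[1/p],V) = ℚ_p κ(x)`,
i.e. `ℒ ≠ 0`; Burns–Kurihara–Sano Conj. 2.8 (i) / Perrin-Riou 1993 — a theorem at good `p`
(Büyükboduk, Bertolini–Darmon–Venerucci, Burungale–Skinner–Tian–Wan), here a free corollary of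
Conj. 12.10⁰: `[H¹(ℤ[1/p],T) : z] = #H²(ℤ[1/p],T)` is finite and non-zero).
[cite: BurnsKuriharaSano2019, Conj. 2.8 (i) (p. 10)] [cite: Kato2004Asterisque, Conj. 12.10 (p. 224), §14.14 (p. 243)] -/
theorem perrinRiou_nonvanishing_of_kmc (hC : RankOneCountReading IsOf PRRatio)
    (hreal : Realizable IsOf) (hread : ReadsTrivialKMC IsOf KMC)
    (hGZK : rank_eq_analyticRank_of_analyticRank_le_one)
    (hr : W.analyticRank = 1) (hp : p ≠ 2) (hadd : Addv W p) (hj : 0 ≤ padicValRat p W.j)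
    (hK : Kato2004.ImageContainsSL2 W p) (hKMC : KMC W p) {ℒ : ℚ_[p]} (hℒ : PRRatio W p ℒ) :
    ℒ ≠ 0 := by
  have hfin : Finite W.sha := (hGZK W (by rw [hr])).2
  obtain ⟨D, hDof⟩ := hreal W p hp hadd hj hK
  obtain ⟨hfinH2, hiff, -⟩ := hC W p D ℒ hr hp hadd hj hK hfin hDof hℒ
  have hμ : D.zetaIndex = D.h2Card :=
    D.zetaIndex_eq_h2Card_of_conj1210 hfinH2 ((hread W p D hDof).mp hKMC)
  exact hiff.mpr (by rw [hμ]; exact (D.h2Card_pos hfinH2).ne')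

/-- **The Burns–Kurihara–Sano direction: KMC⁰ ∧ BSD_p ⇒ PR^×** (their Thm. 7.3 at `r = 1`: the Main
Conjecture ALONE pins `z = u·(#Ш·Tam/#tors²)·log_ω(x)·x`, `u ∈ ℤ_p^×`; with BSD_p the factor is
`L′(E,1)/(Ω·Reg)` up to a unit). Over Readings 1″, 3, 4 and the interface lemma.
[cite: BurnsKuriharaSano2019, Thm. 7.3 (p. 29) and Thm. 7.8 (d) (p. 30)] [cite: Kato2004Asterisque, Conj. 12.10 (p. 224)] -/
theorem perrinRiouUpToUnitAt_of_kmc_of_missingPPartAt (hC : RankOneCountReading IsOf PRRatio)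
    (hrat : HasPRRatio PRRatio) (hreal : Realizable IsOf) (hread : ReadsTrivialKMC IsOf KMC)
    (hGZK : rank_eq_analyticRank_of_analyticRank_le_one) (hmod : hasEntireLFunction_rat)
    (hr : W.analyticRank = 1) (hp : p ≠ 2) (hadd : Addv W p) (hj : 0 ≤ padicValRat p W.j)
    (hK : Kato2004.ImageContainsSL2 W p) (hKMC : KMC W p) (hbsd : MissingPPartAt W p) :
    PerrinRiouUpToUnitAt PRRatio W p := by
  intro _
  have hfin : Finite W.sha := (hGZK W (by rw [hr])).2
  obtain ⟨D, hDof⟩ := hreal W p hp hadd hj hK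
  obtain ⟨ℒ, hℒ⟩ := hrat W p hr hp hadd hj hK
  obtain ⟨hfinH2, hiff, hcount⟩ := hC W p D ℒ hr hp hadd hj hK hfin hDof hℒ
  have hμ : D.zetaIndex = D.h2Card :=
    D.zetaIndex_eq_h2Card_of_conj1210 hfinH2 ((hread W p D hDof).mp hKMC)
  have hne : ℒ ≠ 0 := hiff.mpr (by rw [hμ]; exact (D.h2Card_pos hfinH2).ne')
  have hval := hcount 0 (by rw [pow_zero, one_mul]; exact hμ)
  obtain ⟨q', hq', hv'⟩ := hbsd
  obtain ⟨q, hq, hvq⟩ := exists_leadingTerm_eq_of_shaAn_eq W p (irr_of_imageContainsSL2 W p hK)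
    (W.leadingLCoeff_ne_zero_holds (hmod W)) hq'
  refine ⟨ℒ, hℒ, hne, q, hq, ?_⟩
  rw [hvq, hv', hval, padicValNat_primaryComponent_sha W p hfin]
  push_cast
  ring

/-- **The converse direction: PR^× ∧ (BSD_p's LOWER half) ⇒ Kato's Conj. 12.10 on the trivial
component, for every realised datum** — PR^× gives `z ≠ 0`, the module-theoretic Thm. 14.5 (3) an
`m` with `[H¹ : z] = p^m·#H²`, the count and PR^× give `ord_p #Ш_an = ord_p #Ш + m`, the lower bound
`m = 0`, and the converse descent (Thm. 12.5 (4), Reading 2) Conj. 12.10⁰. So every (12.5.2) rank-one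
row closed by ANY means proves `KMC⁰` for that curve GRANTED PR^× there (at `p ∤ 2N` PR is a theorem).
[cite: Kato2004Asterisque, Conj. 12.10 (p. 224), Thm. 12.5 (4) (p. 222), Thm. 14.5 (3) (p. 236)]
[cite: BurnsKuriharaSano2019, Thm. 7.3 (p. 29)] -/
theorem conj1210_of_perrinRiou_of_missingLowerBoundAt (hC : RankOneCountReading IsOf PRRatio)
    (hdiv : DivisibilityReading IsOf) (hGZK : rank_eq_analyticRank_of_analyticRank_le_one)
    (hmod : hasEntireLFunction_rat) (D : KatoDescentDatum p)
    (hr : W.analyticRank = 1) (hp : p ≠ 2) (hadd : Addv W p) (hj : 0 ≤ padicValRat p W.j)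
    (hK : Kato2004.ImageContainsSL2 W p) (hDof : IsOf W p D) (hPR : PerrinRiouUpToUnitAt PRRatio W p)
    (hlow : MissingLowerBoundAt W p) : D.Conj1210 := by
  have hfin : Finite W.sha := (hGZK W (by rw [hr])).2
  obtain ⟨ℒ, hℒ, hne, q, hq, hv⟩ := hPR hr
  obtain ⟨hfinH2, hiff, hcount⟩ := hC W p D ℒ hr hp hadd hj hK hfin hDof hℒ
  have hD := hdiv W p D hp hadd hj hK hDof
  obtain ⟨m, hm⟩ := D.exists_zetaIndex_eq_pow_mul hfinH2 hD (hiff.mp hne)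
  have hval := hcount m hm
  obtain ⟨q', hq', hv'⟩ := exists_shaAn_eq_of_leadingTerm_eq W p (irr_of_imageContainsSL2 W p hK)
    (W.leadingLCoeff_ne_zero_holds (hmod W)) hq
  have hvm : padicValRat p q' = padicValNat p W.shaOrder + m := by
    rw [hv', ← hv, hval, padicValNat_primaryComponent_sha W p hfin]
    ring
  -- the lower bound pins `m = 0` (the rational value of `#Ш_an` is unique)
  obtain ⟨-, hm0⟩ := missingLowerBoundAt_iff_of_shaAn_eq W p hq' hvm
  rw [hm0.mp hlow, pow_zero, one_mul] at hm
  exact D.conj1210_of_zetaIndex_eq_h2Card hfinH2 hD hm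

/-- **… in `KMC` currency: PR^× ∧ (BSD_p's lower half) ⇒ `KMC W p`** (plus Realizability and the
interface lemma). [cite: Kato2004Asterisque, Conj. 12.10 (p. 224), Thm. 12.5 (4) (p. 222)] [cite: BurnsKuriharaSano2019, Thm. 7.3 (p. 29)] -/
theorem kmc_of_perrinRiou_of_missingLowerBoundAt (hC : RankOneCountReading IsOf PRRatio)
    (hdiv : DivisibilityReading IsOf) (hreal : Realizable IsOf) (hread : ReadsTrivialKMC IsOf KMC)
    (hGZK : rank_eq_analyticRank_of_analyticRank_le_one) (hmod : hasEntireLFunction_rat)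
    (hr : W.analyticRank = 1) (hp : p ≠ 2) (hadd : Addv W p) (hj : 0 ≤ padicValRat p W.j)
    (hK : Kato2004.ImageContainsSL2 W p) (hPR : PerrinRiouUpToUnitAt PRRatio W p)
    (hlow : MissingLowerBoundAt W p) : KMC W p := by
  obtain ⟨D, hDof⟩ := hreal W p hp hadd hj hK
  exact (hread W p D hDof).mpr (conj1210_of_perrinRiou_of_missingLowerBoundAt W p hC hdiv hGZK hmod
    D hr hp hadd hj hK hDof hPR hlow)

/-- **Rank one, GRANTED PR^× at the pair: `KMC W p ⟺ BSD_p`'s lower half `⟺ BSD_p`** (PROPOSITION M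
of `O6/MainConjectureEvenIffBSD.lean` in analytic rank ONE, at every odd additive potentially good
`p` under (12.5.2)). [cite: Kato2004Asterisque, Conj. 12.10 (p. 224), Thm. 12.5 (4) (p. 222)]
[cite: BurnsKuriharaSano2019, Thm. 7.3 and Thm. 7.6 (p. 29)] -/
theorem rankOne_kmc_iff_missingPPartAt_of_perrinRiou (hC : RankOneCountReading IsOf PRRatio)
    (hdiv : DivisibilityReading IsOf) (hreal : Realizable IsOf) (hread : ReadsTrivialKMC IsOf KMC)
    (hGZK : rank_eq_analyticRank_of_analyticRank_le_one) (hmod : hasEntireLFunction_rat)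
    (hr : W.analyticRank = 1) (hp : p ≠ 2) (hadd : Addv W p) (hj : 0 ≤ padicValRat p W.j)
    (hK : Kato2004.ImageContainsSL2 W p) (hPR : PerrinRiouUpToUnitAt PRRatio W p) :
    (KMC W p ↔ MissingLowerBoundAt W p) ∧ (KMC W p ↔ MissingPPartAt W p) := by
  refine ⟨⟨fun h ↦ (lower_and_upper_of_missingPPartAt W p
      (rankOne_missingPPartAt_of_kmc_of_perrinRiou W p hC hreal hread hGZK hmod hr hp hadd hj hK hPR
        h)).1,
    kmc_of_perrinRiou_of_missingLowerBoundAt W p hC hdiv hreal hread hGZK hmod hr hp hadd hj hK hPR⟩,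
    ⟨rankOne_missingPPartAt_of_kmc_of_perrinRiou W p hC hreal hread hGZK hmod hr hp hadd hj hK hPR,
      fun h ↦ kmc_of_perrinRiou_of_missingLowerBoundAt W p hC hdiv hreal hread hGZK hmod hr hp hadd
        hj hK hPR (lower_and_upper_of_missingPPartAt W p h).1⟩⟩

/-- **Rank one, GRANTED KMC⁰ at the pair: `BSD_p ⟺ PR^×`** — the rank-one residue after KMC⁰ is
EXACTLY PR^× (Burns–Kurihara–Sano Thm. 7.3 ∧ Thm. 7.6 on the (12.5.2) rows).
[cite: BurnsKuriharaSano2019, Thm. 7.3 and Thm. 7.6 (p. 29)] [cite: Kato2004Asterisque, Conj. 12.10 (p. 224)] -/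
theorem missingPPartAt_iff_perrinRiou_of_kmc (hC : RankOneCountReading IsOf PRRatio)
    (hrat : HasPRRatio PRRatio) (hreal : Realizable IsOf) (hread : ReadsTrivialKMC IsOf KMC)
    (hGZK : rank_eq_analyticRank_of_analyticRank_le_one) (hmod : hasEntireLFunction_rat)
    (hr : W.analyticRank = 1) (hp : p ≠ 2) (hadd : Addv W p) (hj : 0 ≤ padicValRat p W.j)
    (hK : Kato2004.ImageContainsSL2 W p) (hKMC : KMC W p) :
    MissingPPartAt W p ↔ PerrinRiouUpToUnitAt PRRatio W p :=
  ⟨perrinRiouUpToUnitAt_of_kmc_of_missingPPartAt W p hC hrat hreal hread hGZK hmod hr hp hadd hj hK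
      hKMC,
    fun h ↦ rankOne_missingPPartAt_of_kmc_of_perrinRiou W p hC hreal hread hGZK hmod hr hp hadd hj hK
      h hKMC⟩

end Descent

/-! ## §3 The shells re-glued through the named node: T-O6-A (A1) and B8 = O7-ss -/

section Shells

/-- **T-O6-A (A1) `O6.RankOneOfKMC` FOLLOWS from the split readings, with `PRKato := PR^×` and the
third interface slot `HtNondeg` instantiated by Kato's (12.5.2)** (`Kato2004.ImageContainsSL2 W 3`):
on the `ClassX4` disjunct this is `rankOne_missingPPartAt_of_kmc_of_perrinRiou` at `p = 3` (wild
additive `3` is potentially good, `ClassO6.padicValRat_j_nonneg`); the `ClassX3` = reducible-mod-`3`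
disjunct is EXCLUDED by (12.5.2) (`irr_of_imageContainsSL2`), i.e. covered vacuously — those rows are
`O6.X3WildOfKMC`'s, not this descent's. NO `p`-adic height: the slot the planner reserved for
height non-degeneracy is idle. Nothing is credited (`KMC`, PR^× are hypotheses).
[cite: Kato2004Asterisque, Conj. 12.10 (p. 224), (12.5.2) (p. 222)] [cite: BurnsKuriharaSano2019, Thm. 7.6 and Remark 7.7 (p. 29)] -/
theorem O6.rankOneOfKMC_of_perrinRiou_readings (hC : RankOneCountReading IsOf PRRatio)
    (hreal : Realizable IsOf) (hread : ReadsTrivialKMC IsOf KMC)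
    (hGZK : rank_eq_analyticRank_of_analyticRank_le_one) (hmod : hasEntireLFunction_rat) :
    O6.RankOneOfKMC KMC (fun W _ _ ↦ PerrinRiouUpToUnitAt PRRatio W 3)
      (fun W _ _ ↦ Kato2004.ImageContainsSL2 W 3) := by
  intro W _ _ hr hX hW hKMC hPR hK
  rcases hX with hX3 | hX4
  · exact absurd (irr_of_imageContainsSL2 W 3 hK) hX3.1
  · have hO : ClassO6 W 3 := ⟨hX4.1, hX4.2.1, hW⟩
    exact rankOne_missingPPartAt_of_kmc_of_perrinRiou W 3 hC hreal hread hGZK hmod hr hX4.1 hX4.2.1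
      hO.padicValRat_j_nonneg hK hPR hKMC

/-- **B8 = O7-ss on its (12.5.2) rows: `KMC⁰ ∧ PR^× ⇒ MissingPPartAt`** for every analytic-rank-one
pair of the O7-ss locus (`O7.SS W p`: odd additive `p` of potentially supersingular type — Gss, (t′),
wild alike; `O7.SS.addv`, `O7.SS.padicValRat_j_nonneg`). RESIDUAL-MAP §I O7-ss said "nothing
formulated in print in either half"; in Kato's currency the object is NAMED: Kato Conj. 12.10⁰ +
Burns–Kurihara–Sano Conj. 2.8 / 1.5 (PR^×), and this is the consumer. Nothing asserted about any pair.
[cite: Kato2004Asterisque, Conj. 12.10 (p. 224)] [cite: BurnsKuriharaSano2019, Conj. 1.5 (p. 5), Thm. 7.6 (p. 29)] -/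
theorem O7.missingPPartAt_ss_of_kmc_of_perrinRiou (hC : RankOneCountReading IsOf PRRatio)
    (hreal : Realizable IsOf) (hread : ReadsTrivialKMC IsOf KMC)
    (hGZK : rank_eq_analyticRank_of_analyticRank_le_one) (hmod : hasEntireLFunction_rat)
    (W : WeierstrassCurve ℚ) [W.IsElliptic] [W.IsGloballyMinimal] (p : ℕ) [Fact p.Prime]
    (hr : W.analyticRank = 1) (hss : O7.SS W p) (hK : Kato2004.ImageContainsSL2 W p)
    (hKMC : KMC W p) (hPR : PerrinRiouUpToUnitAt PRRatio W p) : MissingPPartAt W p :=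
  rankOne_missingPPartAt_of_kmc_of_perrinRiou W p hC hreal hread hGZK hmod hr hss.addv.1 hss.addv.2
    hss.padicValRat_j_nonneg hK hPR hKMC

/-- **The planner's closure-map row "O7-ss / (t′) / O6-X4, r = 1" as ONE implication over the split
readings: the class conjecture `O7.PPartSS` restricted to the (12.5.2) rows FOLLOWS from KMC⁰ and PR^×
on those rows.** [cite: Kato2004Asterisque, Conj. 12.10 (p. 224)] [cite: BurnsKuriharaSano2019, Conj. 1.5 (p. 5), Thm. 7.6 (p. 29)] -/
theorem O7.pPartSS_bigImage_of_kmc_of_perrinRiou (hC : RankOneCountReading IsOf PRRatio)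
    (hreal : Realizable IsOf) (hread : ReadsTrivialKMC IsOf KMC)
    (hGZK : rank_eq_analyticRank_of_analyticRank_le_one) (hmod : hasEntireLFunction_rat)
    (hKMC : ∀ (W : WeierstrassCurve ℚ) [W.IsElliptic] [W.IsGloballyMinimal] (p : ℕ) [Fact p.Prime],
      W.analyticRank = 1 → O7.SS W p → Kato2004.ImageContainsSL2 W p → KMC W p)
    (hPR : ∀ (W : WeierstrassCurve ℚ) [W.IsElliptic] [W.IsGloballyMinimal] (p : ℕ) [Fact p.Prime],
      W.analyticRank = 1 → O7.SS W p → Kato2004.ImageContainsSL2 W p →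
      PerrinRiouUpToUnitAt PRRatio W p) :
    ∀ (W : WeierstrassCurve ℚ) [W.IsElliptic] [W.IsGloballyMinimal] (p : ℕ) [Fact p.Prime],
      W.analyticRank = 1 → O7.SS W p → Kato2004.ImageContainsSL2 W p → MissingPPartAt W p :=
  fun W _ _ p _ hr hss hK ↦ O7.missingPPartAt_ss_of_kmc_of_perrinRiou hC hreal hread hGZK hmod W p hr
    hss hK (hKMC W p hr hss hK) (hPR W p hr hss hK)

end Shells

end Summit.BirchSwinnertonDyer.Rank1Residual.Additive

end
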